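import Literature.Computability.QuantumComplexity.QuantumTuring
import Literature.Computability.Cryptography.QuantumTuringMachinePositionedOblivious
import HarnessLib

/-!
# `BQPQTM = BQP` (quantum-advantage S04): the reduction to Yao's simulation theorem and to the Nishimura–Ozawa simulation lemma

Sibling proof file of `QuantumTuring.lean` for the named fact
`Literature.Computability.QuantumComplexity.BQPQTM_eq_BQP` (`BQPQTM = BQP`: Bernstein–Vazirani's
polynomial-time well-formed quantum Turing machines with polynomial-time computable amplitudes,
measured at a fixed polynomial time, versus polynomial-time uniform Clifford+T circuit families).
The fact is the theorem **BQP = BUPQC** of Nishimura–Ozawa (Theoret. Comput. Sci. 276 (2002),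
Thm. 5.2 in the numbering of arXiv:quant-ph/9906095, pp. 18–19 of that text), transported to the
tree's conventions (Clifford+T instead of the gate set `𝒢_PC` of rotations by polynomial-time
computable angles, which costs one application of the Solovay–Kitaev theorem, Nielsen–Chuang 2010,
App. 3, Thm. A3.1; Mathlib's `TM2` model for the uniformity machine; control-state measurement at
an exact polynomial time instead of stationary normal-form halting, Bernstein–Vazirani 1997 §8 and
Nishimura–Ozawa Remark 2 after Thm. 5.2).

This file does NOT discharge the fact (triaged XL: both directions are theories — Yao's
step-by-step circuit simulation of a QTM with Solovay–Kitaev compilation and a `TM2` uniformity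
proof on one side, the Bernstein–Vazirani toolkit of reversible, synchronised, dovetailed
well-formed QTMs on the other; none of it is in Mathlib or in the tree). It records, with complete
proofs and WITHOUT introducing any new named fact (D-0026), the glue of the printed proof: the two
halves of Nishimura–Ozawa's argument are written out as explicit hypotheses of the reduction
theorems, in exactly the form in which they enter, so that whoever proves them closes
`BQPQTM_eq_BQP` by `BQPQTM_eq_BQP_of`.

* `BQPQTM_subset_BQPWith_of` — from **Yao's simulation theorem in uniform, approximate form**
  (hypothesis `hYao`: every well-formed QTM with polynomial-time computable amplitudes, run for
  `p(|x|)` steps, is simulated to any constant accuracy `ε > 0` in acceptance probability by a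
  polynomial-time uniform, oracle-free Clifford+T family; Yao 1993; Nishimura–Ozawa 2002 Thm. 4.3
  and the first half of the proof of Thm. 5.2, "this QTM `M` can be `p(n)`-simulated by a quantum
  circuit `K_n` of size `O(p²(n))` … there is a DTM which on input `1ⁿ` produces the code `c(K_n)`
  in time polynomial in `n`", followed by Solovay–Kitaev compilation of the finitely many gates
  `G₁, G₂` into Clifford+T words, Nielsen–Chuang 2010 Thm. A3.1) one gets
  `BQPQTM ⊆ BQPWith cliffordT ε'` for every `ε' > 1/3`;
* `BQPQTM_subset_BQP_of` — composing with error reduction for uniform Clifford+T families, the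
  tree's named fact `Literature.Computability.Cryptography.BQP_eq_BQPWith`
  (`BQPWith cliffordT ε = BQP` for `0 < ε < 1/2`; Bernstein–Vazirani 1997 §8), gives
  `BQPQTM ⊆ BQP`;
* `BQP_subset_BQPQTM_of` — from the **Nishimura–Ozawa simulation lemma** (hypothesis `hNO`:
  every polynomial-time uniform, oracle-free Clifford+T family is carried out *exactly* by a
  well-formed QTM with polynomial-time computable amplitudes whose control state, observed at a
  fixed polynomial time `q(|x|)`, is accepting with probability equal to the family's acceptance
  probability; Nishimura–Ozawa 2002 Lemma 5.1 and the second half of the proof of Thm. 5.2, with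
  the four Clifford+T gates in place of `𝒢_R` — their amplitudes `±1/√2, i, e^{iπ/4}` are
  polynomial-time computable — and the accepting/rejecting control states made persistent by the
  completion lemma, Lemma 3.1, so that any polynomial `q` dominating the running time serves) one
  gets `BQP ⊆ BQPQTM`;
* `BQPQTM_eq_BQP_of` — both inclusions together: `BQPQTM_eq_BQP`.

And, over the positioned (Bernstein–Vazirani) model of
`Cryptography/QuantumTuringMachinePositioned.lean` — configurations `QTM.PCfg M = M.Cfg × ℤ` with
ABSOLUTE head position, i.e. Bernstein–Vazirani's `Q × Σ^# × ℤ`, with `QTM.pevolve`,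
`QTM.PIsWellFormed`, `QTM.pacceptProbAt` and the classes `BQPQTMPosWith`, `BQPQTMPos` (see the
model caveat below):

* `BQPQTMPos_subset_BQPWith_of`, `BQPQTMPos_subset_BQP_of`, `BQP_subset_BQPQTMPos_of`,
  `BQPQTMPos_eq_BQP_of` — the same glue for the FAITHFUL statement `BQPQTMPos = BQP`, i.e. for
  Nishimura–Ozawa's Theorem 5.2 with machines, well-formedness and acceptance read in the model
  in which it is printed (the hypotheses `hYao`, `hNO` are then the printed simulation theorems,
  Thm. 4.3 with Solovay–Kitaev and Lemma 5.1, up to the gate-set / uniformity / fixed-time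
  conventions);
* `BQP_subset_BQPQTM_of_pos`, `BQPQTM_eq_BQP_of_pos` — the bridge back to the tree's statement:
  the printed Lemma 5.1 produces STATIONARY machines (head back on the start cell at the final
  time on every computation path, Bernstein–Vazirani 1997 Def. 3.12), for which the tree's
  acceptance probability is Bernstein–Vazirani's (`QTM.acceptProbAt_eq_pacceptProbAt`,
  `…PositionedOblivious.lean`) and BV well-formedness is the tree's
  (`QTM.isWellFormed_of_pIsWellFormed`); so the inclusion `BQP ⊆ BQPQTM` of the tree's S04
  follows from the printed construction formalised in the printed model, and only the
  hypothesis side of `⊆` (an ARBITRARY tree machine, `hYao` in the tree's semantics) keeps the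
  tree's S04 apart from the source;
* `RotationWalk.pacceptProbAt_nil_two` — the Bernstein–Vazirani number `288/625` of the model
  caveat, proved in the positioned model (tree: `576/625`, `RotationWalk.acceptProbAt_nil_two`).

## Model caveat (recorded for whoever proves `hYao`; proved below as `QTM_blankCfg_move_left_eq_move_right`)

The tree's QTM configurations (`Literature.Computability.Cryptography.QTM.Cfg`, prelude Q8) carry
a Mathlib `Turing.Tape`, i.e. the tape content *relative to the head*, padded with blanks
(`ListBlank`); Bernstein–Vazirani and Nishimura–Ozawa configurations `(q, T, ξ)` carry an
absolute head position `ξ ∈ ℤ` (Nishimura–Ozawa 2002, §2). The two agree up to translation,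
except that the tree identifies translates: on the all-blank tape, "write blank, move left" and
"write blank, move right" into the same control state reach ONE configuration of the tree
(`QTM_blankCfg_move_left_eq_move_right`), two orthogonal ones in the papers. Consequently
`QTM.evolve` adds the two amplitudes. More generally (review of S05, 2026-08-15; the section
"The model caveat, sharpened" at the end of this file): tree configurations are exactly the
translation classes of Bernstein–Vazirani configurations, `QTM.evolve` is the operator induced
on classes by BV's time evolution `U` (which commutes with translations), and the amplitudes of
ALL translates present in a superposition are added — not only on the blank tape. Writing `π`
for "sum the amplitudes over each translation class" and `τ_k` for translation by `k`, one has
`evolve ∘ π = π ∘ U` and `⟪π v, π w⟫ = ∑_{k ∈ ℤ} ⟪v, w ∘ τ_k⟫` (formalised since in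
`Cryptography/QuantumTuringMachinePositioned.lean`: `QTM.mapDomain_fst_pevolve`,
`QTM.mapDomain_fst_pstateAt`, `QTM.isWellFormed_of_pIsWellFormed`; the converse direction of
(1) below in `…PositionedFaithful.lean`). Two consequences: (1) a BV-well-formed transition
table is tree-well-formed (the Gram matrix of the images of the classes is the identity
because `U` is an isometry and `(U δ_c) ∘ τ_k = U δ_{τ_{-k} c}`), and conversely as soon as the tape alphabet has a non-blank
symbol (a far-away witness cell separates translates), so `QTM.IsWellFormed` agrees with
Bernstein–Vazirani 1997, Def. 3.3 / Thm. 5.3; but (2) the observable statistics differ: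
`acceptProbAt x t = ∑_k ⟪P_acc U^t δ_{init x}, P_acc U^t δ_{τ_k (init x)}⟫`, i.e. BV's
acceptance probability PLUS the interference between the run and its own translates, and the
cross terms do not vanish in general — already for the unidirectional, never-writing two-state
machine `RotationWalk.machine` below, whose amplitudes lie in `adhAmplitudes`: on the empty
input after two steps the tree gives `Pr[accept] = 576/625`
(`RotationWalk.acceptProbAt_nil_two`, proved), Bernstein–Vazirani's model `288/625` (four
orthogonal paths; `RotationWalk.pacceptProbAt_nil_two`, proved in the positioned model). Unidirectionality is therefore NOT sufficient for the two semantics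
to agree; what suffices is that no two translates of one configuration ever occur together in a
reachable superposition (e.g. machines that keep a unique marker cell, which the
Nishimura–Ozawa constructions for `hNO` can arrange), whereas on the hypothesis side (`hYao`,
and the inclusion `BQPQTM ⊆ BQPQTMWith adhAmplitudes` of S05) an ARBITRARY well-formed
machine must be simulated in the tree's semantics (e.g. by simulating the class dynamics on
canonical forms), which the printed proofs do not do. The faithful repair is in Q8, not here:
add the absolute head position `pos : ℤ` to `QTM.Cfg` (`init`: `pos = 0`; `evolve`: `pos ∓ 1`);
then `Cfg` is in bijection with BV configurations (`T z = tape.nth (z - pos)`), S03–S05 become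
the printed statements up to the documented fixed-time measurement convention, and
`QTM_blankCfg_move_left_eq_move_right` together with the `RotationWalk` section (which document
the defect) are to be deleted. The class identity
`BQPQTM = BQP` itself is very plausibly insensitive to the discrepancy.

## References

* H. Nishimura, M. Ozawa, *Computational complexity of uniform quantum circuit families and
  quantum Turing machines*, Theoret. Comput. Sci. 276 (2002) 147–181 = arXiv:quant-ph/9906095
  [NishimuraOzawa2002]: Thm. 2.1, Lemma 3.1 (completion), Thm. 3.3 (synchronization), Lemmas
  3.4–3.6, Thm. 4.3 (circuits simulate QTMs), Lemma 5.1 (QTMs simulate uniform QCFs), Thm. 5.2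
  (`BQP = BUPQC`), Remark 2 (exact polynomial running time) — arXiv numbering, read from the
  materialised arXiv text; the journal pagination was not accessible.
* H. Nishimura, M. Ozawa, *Perfect computational equivalence between quantum Turing machines and
  finitely generated uniform quantum circuit families*, Quantum Inf. Process. 8 (2009) 13–24 =
  arXiv:quant-ph/0511117 [NishimuraOzawa2009]: Prop. 4.3 (exact decomposition with
  polynomial-time computable entries), Thm. 4.4 (exact simulation of QTMs by finitely generated
  uniform QCFs), Thm. 4.5 (perfect equivalence), and the closing remark of §4 (finitely generated
  uniform QCFs are exactly simulated by QTMs, by Lemma 5.1 of the 2002 paper) — read from the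
  materialised arXiv text.
* A. C.-C. Yao, *Quantum circuit complexity*, Proc. 34th FOCS (1993) 352–361 [YaoFOCS1993].
* E. Bernstein, U. Vazirani, *Quantum complexity theory*, SIAM J. Comput. 26 (1997) 1411–1473
  [BernsteinVaziraniSICOMP1997], §8.
* M. A. Nielsen, I. L. Chuang, *Quantum Computation and Quantum Information*, CUP 2010
  [NielsenChuang2010], App. 3, Thm. A3.1 (Solovay–Kitaev).
-/

namespace Literature.Computability.QuantumComplexity

open Cryptography Complexity Turing

/-! ### The model caveat -/

/-- In Mathlib's blank-padded lists, a single blank is no list at all: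
`ListBlank.mk [default] = ListBlank.mk []`. [folklore] -/
theorem listBlank_mk_default_eq_nil {Γ : Type} [Inhabited Γ] :
    (ListBlank.mk [default] : ListBlank Γ) = ListBlank.mk [] :=
  Quotient.sound' (Or.inr ⟨1, rfl⟩)

/-- **The tree's QTM configurations identify translates** (model caveat of the module
docstring): for every machine `M` and control state `q`, starting from the initial configuration
on the empty input (all-blank tape), writing the blank and moving LEFT into `q` yields the same
configuration of `M` as writing the blank and moving RIGHT into `q` — whereas in
Bernstein–Vazirani's and Nishimura–Ozawa's configuration space `Q × Σ^# × ℤ` (Nishimura–Ozawa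
2002, §2) these are two orthogonal basis states. Hence `QTM.evolve` superposes the amplitudes
`δ p a q blank left` and `δ p a q blank right` on one basis configuration. [folklore] -/
theorem QTM_blankCfg_move_left_eq_move_right (M : QTM) (q : M.Λ) :
    (⟨q, ((M.init []).tape.write default).move Dir.left⟩ : M.Cfg) =
      ⟨q, ((M.init []).tape.write default).move Dir.right⟩ := by
  have h1 : (M.init []).tape = Tape.mk₁ [] := rfl
  have h2 : (Tape.mk₁ ([] : List M.Γ)).write default = Tape.mk₁ [] := by
    simp [Tape.mk₁, Tape.mk₂, Tape.mk', Tape.write]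
  rw [h1, h2]
  congr 1
  simp [Tape.mk₁, Tape.mk₂, Tape.move_left_mk', Tape.move_right_mk', listBlank_mk_default_eq_nil]

/-! ### The glue -/

/-- **`BQPQTM ⊆ BQPWith cliffordT ε'` for every `ε' > 1/3`, from Yao's simulation theorem.**
The hypothesis `hYao` is Yao's theorem in uniform approximate form (Yao 1993; Nishimura–Ozawa
2002, Thm. 4.3 and proof of Thm. 5.2, first half; Solovay–Kitaev, Nielsen–Chuang 2010 Thm. A3.1):
a well-formed QTM `M` with polynomial-time computable amplitudes, run for `p(|x|)` steps, is
simulated within any accuracy `ε > 0` in acceptance probability by a polynomial-time uniform,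
oracle-free Clifford+T family (acceptance probability in the TREE's semantics `QTM.acceptProbAt`;
see the model caveat of the module docstring). Applied with accuracy `ε' - 1/3`, the thresholds
`(2/3, 1/3)` of `BQPQTM` become `(1 - ε', ε')`. [cite: NishimuraOzawa2002, Thm. 5.2 (proof, first half) and Thm. 4.3] -/
theorem BQPQTM_subset_BQPWith_of
    (hYao : ∀ (M : QTM) (p : Polynomial ℕ) (ε : ℝ), M.IsWellFormed →
      M.amplitudes ⊆ polyTimeComputableComplex → 0 < ε →
        ∃ F : QCircuitFamily cliffordT, F.IsOracleFree ∧ F.IsUniform ∧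
          ∀ x : List Bool, |F.acceptProbOn 0 x - M.acceptProbAt x (p.eval x.length)| ≤ ε)
    {ε' : ℝ} (hε' : 1 / 3 < ε') :
    BQPQTM ⊆ BQPWith cliffordT ε' := by
  intro L hL
  obtain ⟨M, p, hwf, hamp, hM⟩ := (mem_BQPQTM_iff L).1 hL
  obtain ⟨F, hfree, hU, hF⟩ := hYao M p (ε' - 1 / 3) hwf hamp (by linarith)
  refine ⟨F, hfree, hU, fun x => ⟨fun hx => ?_, fun hx => ?_⟩⟩
  · have h1 := (hM x).1 hx
    have h2 := (abs_le.1 (hF x)).1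
    linarith
  · have h1 := (hM x).2 hx
    have h2 := (abs_le.1 (hF x)).2
    linarith

/-- **`BQPQTM ⊆ BQP` from Yao's simulation theorem and error reduction** (Nishimura–Ozawa 2002,
Thm. 5.2, inclusion `BQP ⊆ BUPQC` of the paper, i.e. QTMs are no stronger than uniform circuit
families; Yao 1993). `hYao` is as in `BQPQTM_subset_BQPWith_of`; `hamp` is the tree's named fact
`Literature.Computability.Cryptography.BQP_eq_BQPWith` (error reduction for uniform Clifford+T
families, Bernstein–Vazirani 1997 §8), used at `ε = 5/12 < 1/2`. [cite: NishimuraOzawa2002, Thm. 5.2 (BQP ⊆ BUPQC)] -/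
theorem BQPQTM_subset_BQP_of
    (hYao : ∀ (M : QTM) (p : Polynomial ℕ) (ε : ℝ), M.IsWellFormed →
      M.amplitudes ⊆ polyTimeComputableComplex → 0 < ε →
        ∃ F : QCircuitFamily cliffordT, F.IsOracleFree ∧ F.IsUniform ∧
          ∀ x : List Bool, |F.acceptProbOn 0 x - M.acceptProbAt x (p.eval x.length)| ≤ ε)
    (hamp : BQP_eq_BQPWith) :
    BQPQTM ⊆ BQP := by
  have h : BQPWith cliffordT (5 / 12 : ℝ) = BQP := hamp (by norm_num) (by norm_num)
  rw [← h]
  exact BQPQTM_subset_BQPWith_of hYao (by norm_num)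

/-- **`BQP ⊆ BQPQTM` from the Nishimura–Ozawa simulation lemma** (Nishimura–Ozawa 2002,
Lemma 5.1 and Thm. 5.2, inclusion `BUPQC ⊆ BQP` of the paper). The hypothesis `hNO` is Lemma 5.1
for Clifford+T-uniform families in the tree's conventions: a polynomial-time uniform, oracle-free
Clifford+T family `F` is carried out exactly by a well-formed QTM `M` with polynomial-time
computable amplitudes (`±1/√2, i, e^{iπ/4}, 0, ±1`) and there is a polynomial `q` such that
observing the control state of `M` after exactly `q(|x|)` steps gives the accepting state with
probability `F.acceptProbOn 0 x` (accept/reject states persistent by the completion lemma,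
Lemma 3.1, so every polynomial dominating the synchronised running time serves). [cite: NishimuraOzawa2002, Lemma 5.1 and Thm. 5.2 (BUPQC ⊆ BQP)] -/
theorem BQP_subset_BQPQTM_of
    (hNO : ∀ F : QCircuitFamily cliffordT, F.IsOracleFree → F.IsUniform →
      ∃ (M : QTM) (q : Polynomial ℕ), M.IsWellFormed ∧
        M.amplitudes ⊆ polyTimeComputableComplex ∧
          ∀ x : List Bool, M.acceptProbAt x (q.eval x.length) = F.acceptProbOn 0 x) :
    BQP ⊆ BQPQTM := by
  intro L hL
  obtain ⟨F, hfree, hU, hF⟩ := ClassBQP.mem_BQP_iff.1 hL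
  obtain ⟨M, q, hwf, hamp, hM⟩ := hNO F hfree hU
  refine (mem_BQPQTM_iff L).2 ⟨M, q, hwf, hamp, fun x => ⟨fun hx => ?_, fun hx => ?_⟩⟩
  · rw [hM x]
    exact (hF x).1 hx
  · rw [hM x]
    exact (hF x).2 hx

/-- **The glue of Nishimura–Ozawa's Theorem 5.2 (`BQP = BUPQC`) in the tree's conventions**:
Yao's simulation theorem in uniform approximate form (`hYao`), error reduction for uniform
Clifford+T families (`hamp`, the tree's named fact `BQP_eq_BQPWith`) and the Nishimura–Ozawa
simulation lemma (`hNO`) together give `BQPQTM_eq_BQP : BQPQTM = BQP`. Proving `hYao` and `hNO`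
(each a theory: Yao 1993 + Solovay–Kitaev + `TM2` uniformity, resp. the Bernstein–Vazirani
toolkit of well-formed QTM programming) closes the fact. [cite: NishimuraOzawa2002, Thm. 5.2] -/
theorem BQPQTM_eq_BQP_of
    (hYao : ∀ (M : QTM) (p : Polynomial ℕ) (ε : ℝ), M.IsWellFormed →
      M.amplitudes ⊆ polyTimeComputableComplex → 0 < ε →
        ∃ F : QCircuitFamily cliffordT, F.IsOracleFree ∧ F.IsUniform ∧
          ∀ x : List Bool, |F.acceptProbOn 0 x - M.acceptProbAt x (p.eval x.length)| ≤ ε)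
    (hamp : BQP_eq_BQPWith)
    (hNO : ∀ F : QCircuitFamily cliffordT, F.IsOracleFree → F.IsUniform →
      ∃ (M : QTM) (q : Polynomial ℕ), M.IsWellFormed ∧
        M.amplitudes ⊆ polyTimeComputableComplex ∧
          ∀ x : List Bool, M.acceptProbAt x (q.eval x.length) = F.acceptProbOn 0 x) :
    BQPQTM_eq_BQP :=
  Set.Subset.antisymm (BQPQTM_subset_BQP_of hYao hamp) (BQP_subset_BQPQTM_of hNO)

/-! ### The glue of Theorem 5.2 for the faithful statement `BQPQTMPos = BQP` -/

/-- **`BQPQTMPos ⊆ BQPWith cliffordT ε'` for every `ε' > 1/3`, from Yao's simulation theorem in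
Bernstein–Vazirani's model** (as `BQPQTM_subset_BQPWith_of`, with the machines, their
well-formedness and their acceptance probabilities read in Bernstein–Vazirani's configuration
space `Q × Σ^# × ℤ` — `QTM.PIsWellFormed` / `QTM.pacceptProbAt` of
`Cryptography/QuantumTuringMachinePositioned.lean` — the model in which Yao 1993 and
Nishimura–Ozawa 2002, Thm. 4.3, are stated and proved). [cite: NishimuraOzawa2002, Thm. 5.2 (proof, first half) and Thm. 4.3] -/
theorem BQPQTMPos_subset_BQPWith_of
    (hYao : ∀ (M : QTM) (p : Polynomial ℕ) (ε : ℝ), M.PIsWellFormed →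
      M.amplitudes ⊆ polyTimeComputableComplex → 0 < ε →
        ∃ F : QCircuitFamily cliffordT, F.IsOracleFree ∧ F.IsUniform ∧
          ∀ x : List Bool, |F.acceptProbOn 0 x - M.pacceptProbAt x (p.eval x.length)| ≤ ε)
    {ε' : ℝ} (hε' : 1 / 3 < ε') :
    BQPQTMPos ⊆ BQPWith cliffordT ε' := by
  rintro L ⟨M, p, hwf, hamp, hM⟩
  obtain ⟨F, hfree, hU, hF⟩ := hYao M p (ε' - 1 / 3) hwf hamp (by linarith)
  refine ⟨F, hfree, hU, fun x => ⟨fun hx => ?_, fun hx => ?_⟩⟩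
  · have h1 := (hM x).1 hx
    have h2 := (abs_le.1 (hF x)).1
    linarith
  · have h1 := (hM x).2 hx
    have h2 := (abs_le.1 (hF x)).2
    linarith

/-- **`BQPQTMPos ⊆ BQP`** from Yao's simulation theorem in Bernstein–Vazirani's model and error
reduction for uniform Clifford+T families (the tree's named fact `BQP_eq_BQPWith`, used at
`ε = 5/12`): the inclusion `BQP ⊆ BUPQC` of Nishimura–Ozawa 2002, Thm. 5.2, for the faithful
class `BQPQTMPos`. [cite: NishimuraOzawa2002, Thm. 5.2 (BQP ⊆ BUPQC)] -/
theorem BQPQTMPos_subset_BQP_of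
    (hYao : ∀ (M : QTM) (p : Polynomial ℕ) (ε : ℝ), M.PIsWellFormed →
      M.amplitudes ⊆ polyTimeComputableComplex → 0 < ε →
        ∃ F : QCircuitFamily cliffordT, F.IsOracleFree ∧ F.IsUniform ∧
          ∀ x : List Bool, |F.acceptProbOn 0 x - M.pacceptProbAt x (p.eval x.length)| ≤ ε)
    (hamp : BQP_eq_BQPWith) :
    BQPQTMPos ⊆ BQP := by
  have h : BQPWith cliffordT (5 / 12 : ℝ) = BQP := hamp (by norm_num) (by norm_num)
  rw [← h]
  exact BQPQTMPos_subset_BQPWith_of hYao (by norm_num)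

/-- **`BQP ⊆ BQPQTMPos` from the Nishimura–Ozawa simulation lemma in Bernstein–Vazirani's
model** (Nishimura–Ozawa 2002, Lemma 5.1 and the second half of the proof of Thm. 5.2, read in
the configuration space `Q × Σ^# × ℤ` in which it is proved: a polynomial-time uniform
oracle-free Clifford+T family is carried out exactly by a machine well formed in BV's sense with
polynomial-time computable amplitudes, observed at a fixed polynomial time). [cite: NishimuraOzawa2002, Lemma 5.1 and Thm. 5.2 (BUPQC ⊆ BQP)] -/
theorem BQP_subset_BQPQTMPos_of
    (hNO : ∀ F : QCircuitFamily cliffordT, F.IsOracleFree → F.IsUniform →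
      ∃ (M : QTM) (q : Polynomial ℕ), M.PIsWellFormed ∧
        M.amplitudes ⊆ polyTimeComputableComplex ∧
          ∀ x : List Bool, M.pacceptProbAt x (q.eval x.length) = F.acceptProbOn 0 x) :
    BQP ⊆ BQPQTMPos := by
  intro L hL
  obtain ⟨F, hfree, hU, hF⟩ := ClassBQP.mem_BQP_iff.1 hL
  obtain ⟨M, q, hwf, hamp, hM⟩ := hNO F hfree hU
  refine ⟨M, q, hwf, hamp, fun x => ⟨fun hx => ?_, fun hx => ?_⟩⟩
  · rw [hM x]
    exact (hF x).1 hx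
  · rw [hM x]
    exact (hF x).2 hx

/-- **The glue of Nishimura–Ozawa's Theorem 5.2 for the FAITHFUL statement `BQPQTMPos = BQP`**
(Bernstein–Vazirani's `BQP`, machines and acceptance read in Bernstein–Vazirani's own
configuration space, versus uniform Clifford+T families): Yao's simulation theorem (`hYao`),
error reduction (`hamp`) and the Nishimura–Ozawa simulation lemma (`hNO`), all in the model in
which they are printed, give `BQPQTMPos = BQP`. This is the form of S04 that Nishimura–Ozawa
2002, Thm. 5.2, actually asserts (up to the documented gate-set, uniformity and fixed-time
measurement conventions); compare `BQPQTM_eq_BQP_of` for the tree's translation-quotient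
statement `BQPQTM_eq_BQP`. [cite: NishimuraOzawa2002, Thm. 5.2] -/
theorem BQPQTMPos_eq_BQP_of
    (hYao : ∀ (M : QTM) (p : Polynomial ℕ) (ε : ℝ), M.PIsWellFormed →
      M.amplitudes ⊆ polyTimeComputableComplex → 0 < ε →
        ∃ F : QCircuitFamily cliffordT, F.IsOracleFree ∧ F.IsUniform ∧
          ∀ x : List Bool, |F.acceptProbOn 0 x - M.pacceptProbAt x (p.eval x.length)| ≤ ε)
    (hamp : BQP_eq_BQPWith)
    (hNO : ∀ F : QCircuitFamily cliffordT, F.IsOracleFree → F.IsUniform →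
      ∃ (M : QTM) (q : Polynomial ℕ), M.PIsWellFormed ∧
        M.amplitudes ⊆ polyTimeComputableComplex ∧
          ∀ x : List Bool, M.pacceptProbAt x (q.eval x.length) = F.acceptProbOn 0 x) :
    BQPQTMPos = BQP :=
  Set.Subset.antisymm (BQPQTMPos_subset_BQP_of hYao hamp) (BQP_subset_BQPQTMPos_of hNO)

/-! ### From the printed (stationary) simulation lemma to the tree's `BQP ⊆ BQPQTM` -/

/-- **`BQP ⊆ BQPQTM` (tree statement) from the Nishimura–Ozawa simulation lemma in
Bernstein–Vazirani's model with STATIONARY final head position.** Nishimura–Ozawa's machines of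
Lemma 5.1 are stationary normal-form machines (2002, §2–3: at the final time the head is back on
the start cell on every computation path; Bernstein–Vazirani 1997, Def. 3.12), so at the
measuring time the head position is path-independent; then the tree's acceptance probability is
Bernstein–Vazirani's (`QTM.acceptProbAt_eq_pacceptProbAt`) and BV well-formedness is the tree's
(`QTM.isWellFormed_of_pIsWellFormed`). Hence the printed construction, formalised in the printed
model, discharges the inclusion `⊇` of the tree's `BQPQTM_eq_BQP` as well.
[cite: NishimuraOzawa2002, Lemma 5.1 and Thm. 5.2 (BUPQC ⊆ BQP)] -/
theorem BQP_subset_BQPQTM_of_pos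
    (hNO : ∀ F : QCircuitFamily cliffordT, F.IsOracleFree → F.IsUniform →
      ∃ (M : QTM) (q : Polynomial ℕ), M.PIsWellFormed ∧
        M.amplitudes ⊆ polyTimeComputableComplex ∧
          (∀ x : List Bool, ∃ ξ : ℤ,
            ∀ c ∈ (M.pstateAt x (q.eval x.length)).support, c.2 = ξ) ∧
          ∀ x : List Bool, M.pacceptProbAt x (q.eval x.length) = F.acceptProbOn 0 x) :
    BQP ⊆ BQPQTM := by
  intro L hL
  obtain ⟨F, hfree, hU, hF⟩ := ClassBQP.mem_BQP_iff.1 hL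
  obtain ⟨M, q, hwf, hamp, hobl, hM⟩ := hNO F hfree hU
  refine (mem_BQPQTM_iff L).2 ⟨M, q, M.isWellFormed_of_pIsWellFormed hwf, hamp, fun x => ?_⟩
  obtain ⟨ξ, hξ⟩ := hobl x
  rw [M.acceptProbAt_eq_pacceptProbAt x _ ξ hξ, hM x]
  exact hF x

/-- **The tree's `BQPQTM_eq_BQP` from Yao's theorem in the tree's semantics and the PRINTED
simulation lemma**: compared with `BQPQTM_eq_BQP_of`, the hypothesis for `⊇` is now the
Nishimura–Ozawa Lemma 5.1 as printed (Bernstein–Vazirani's model, stationary machines), and only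
the hypothesis for `⊆` (`hYao`, an arbitrary tree-well-formed machine simulated in the tree's
translation-quotient semantics) still differs from the source. [cite: NishimuraOzawa2002, Thm. 5.2] -/
theorem BQPQTM_eq_BQP_of_pos
    (hYao : ∀ (M : QTM) (p : Polynomial ℕ) (ε : ℝ), M.IsWellFormed →
      M.amplitudes ⊆ polyTimeComputableComplex → 0 < ε →
        ∃ F : QCircuitFamily cliffordT, F.IsOracleFree ∧ F.IsUniform ∧
          ∀ x : List Bool, |F.acceptProbOn 0 x - M.acceptProbAt x (p.eval x.length)| ≤ ε)
    (hamp : BQP_eq_BQPWith)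
    (hNO : ∀ F : QCircuitFamily cliffordT, F.IsOracleFree → F.IsUniform →
      ∃ (M : QTM) (q : Polynomial ℕ), M.PIsWellFormed ∧
        M.amplitudes ⊆ polyTimeComputableComplex ∧
          (∀ x : List Bool, ∃ ξ : ℤ,
            ∀ c ∈ (M.pstateAt x (q.eval x.length)).support, c.2 = ξ) ∧
          ∀ x : List Bool, M.pacceptProbAt x (q.eval x.length) = F.acceptProbOn 0 x) :
    BQPQTM_eq_BQP :=
  Set.Subset.antisymm (BQPQTM_subset_BQP_of hYao hamp) (BQP_subset_BQPQTM_of_pos hNO)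

/-! ### The model caveat, sharpened: a two-state machine with Adleman–DeMarrais–Huang amplitudes

The transition table below (`RotationWalk.machine`) never changes the tape: in control state `p`
reading `a` it rewrites `a`, enters `q` with amplitude `Rθ[q, p]`, where `Rθ` is the rotation with
`cos θ = 3/5`, `sin θ = 4/5` (`Rθ e_r = -(4/5) e_ℓ + (3/5) e_r`, `Rθ e_ℓ = (3/5) e_ℓ + (4/5) e_r`;
states `ℓ = false`, `r = true`), and moves left when entering `ℓ`, right when entering `r`. It is
unidirectional and satisfies the local well-formedness conditions of Bernstein–Vazirani 1997,
Thm. 5.3 (unit length and orthogonality: the columns of `Rθ`; separability: vacuous for a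
unidirectional table), so it is a well-formed QTM of Bernstein–Vazirani with amplitudes in
`{0, 3/5, ±4/5} ⊆ adhAmplitudes` (`RotationWalk.amplitudes_subset`). In Bernstein–Vazirani's
model (Def. 3.1–3.2: tape cells indexed by `ℤ`, configurations record the head cell), started in
`r` on the empty input, after two steps the superposition is
`-(12/25)|ℓ,-2⟩ - (16/25)|r,0⟩ - (12/25)|ℓ,0⟩ + (9/25)|r,2⟩` (four orthogonal configurations),
so the state `ℓ` is observed with probability `288/625` (`RotationWalk.pstateAt_nil_two`,
`RotationWalk.pacceptProbAt_nil_two`, in the positioned model `QTM.PCfg` of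
`Cryptography/QuantumTuringMachinePositioned.lean`). In the tree the translates `|ℓ,-2⟩,
|ℓ,0⟩` and `|r,0⟩, |r,2⟩` are one configuration each, the amplitudes add to `-24/25` and `-7/25`
(rotation by `2θ`), and `acceptProbAt [] 2 = 576/625` (`RotationWalk.acceptProbAt_nil_two`).
This section exists only to document the discrepancy and is to be deleted with the Q8 repair
described in the module docstring.
-/

namespace RotationWalk

/-- Entry (row `q`, column `p`) of the rotation `Rθ`, `cos θ = 3/5`, `sin θ = 4/5`, on the two
control states `ℓ = false`, `r = true`. [folklore] -/
noncomputable def rot : Bool → Bool → ℂ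
  | false, false => 3 / 5
  | true, false => 4 / 5
  | false, true => -4 / 5
  | true, true => 3 / 5

/-- The head direction forced by the target state (`ℓ`: left, `r`: right): the table is
unidirectional in the sense of Bernstein–Vazirani 1997, Def. 3.14. [folklore] -/
def dirOf : Bool → Dir
  | false => Dir.left
  | true => Dir.right

/-- The two-state rotation walk: rewrite the scanned symbol, enter `q` with amplitude
`rot q p`, move in direction `dirOf q`; start state `r`, accepting state `ℓ`. (`reducible`, so
that `machine.Λ = Bool` is seen by instance search.) [folklore] -/
@[reducible] noncomputable def machine : QTM where
  Λ := Bool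
  Γ := Bool
  start := true
  accept := false
  embed := id
  δ := fun p a q b d => if b = a ∧ d = dirOf q then rot q p else 0

/-- Its amplitudes lie in the Adleman–DeMarrais–Huang set `{0, ±1, ±3/5, ±4/5}`. [folklore] -/
theorem amplitudes_subset : machine.amplitudes ⊆ adhAmplitudes := by
  rintro z ⟨p, a, q, b, d, rfl⟩
  dsimp only
  split_ifs
  · cases q <;> cases p <;> simp [rot, adhAmplitudes]
  · simp [adhAmplitudes]

/-- The all-blank tape. [folklore] -/
def blank : Tape Bool := Tape.mk₁ []

/-- Writing the blank on the all-blank tape changes nothing. [folklore] -/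
theorem blank_write : blank.write false = blank := by
  simp [blank, Tape.mk₁, Tape.mk₂, Tape.mk', Tape.write]

/-- Moving on the all-blank tape changes nothing (Mathlib's `Tape` is head-relative). [folklore] -/
theorem blank_move (d : Dir) : blank.move d = blank := by
  have h : (ListBlank.mk [false] : ListBlank Bool) = ListBlank.mk [] :=
    listBlank_mk_default_eq_nil
  cases d <;>
  simp [blank, Tape.mk₁, Tape.mk₂, Tape.move_left_mk', Tape.move_right_mk', h]

/-- The two configurations on the all-blank tape. [folklore] -/
def cfg (q : Bool) : machine.Cfg := ⟨q, blank⟩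

/-- `cfg` is injective. [folklore] -/
theorem cfg_injective : Function.Injective cfg := fun a b h => by
  simpa [cfg] using congrArg QTM.Cfg.q h

/-- One step from a blank-tape configuration: both head moves land on the same tree
configuration, so the step is `Rθ` on the control state. [folklore] -/
theorem evolve_single_cfg (p : Bool) (a : ℂ) :
    machine.evolve (Finsupp.single (cfg p) a) =
      Finsupp.single (cfg false) (a * rot false p) + Finsupp.single (cfg true) (a * rot true p) := by
  rw [QTM.evolve_single]
  simp only [cfg]
  erw [Fintype.sum_bool, Fintype.sum_bool, Fintype.sum_bool]
  simp only [show blank.head = false from rfl, blank_write, blank_move]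
  simp [dirOf]
  exact add_comm _ _

/-- `QTM.evolve` is additive. [folklore] -/
theorem _root_.Literature.Computability.Cryptography.QTM.evolve_add (M : QTM) (f g : M.Cfg →₀ ℂ) :
    M.evolve (f + g) = M.evolve f + M.evolve g := by
  unfold QTM.evolve
  apply Finsupp.sum_add_index'
  · intro c
    simp
  · intro c a₁ a₂
    simp only [add_mul, add_smul, Finset.sum_add_distrib]
    abel

/-- After one step on the empty input: `-(4/5)|ℓ⟩ + (3/5)|r⟩`. [folklore] -/
theorem stateAt_nil_one :
    machine.stateAt [] 1 = Finsupp.single (cfg false) (-4 / 5) + Finsupp.single (cfg true) (3 / 5) := by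
  show machine.evolve (Finsupp.single (machine.init []) 1) = _
  rw [show machine.init [] = cfg true from rfl, evolve_single_cfg]
  simp [rot]

/-- After two steps on the empty input only TWO configurations carry amplitude,
`-(24/25)|ℓ⟩ - (7/25)|r⟩` (Bernstein–Vazirani: four, see the section docstring). [folklore] -/
theorem stateAt_nil_two :
    machine.stateAt [] 2 =
      Finsupp.single (cfg false) (-24 / 25) + Finsupp.single (cfg true) (-7 / 25) := by
  show machine.evolve (machine.evolve (Finsupp.single (machine.init []) 1)) = _
  have h1 : machine.evolve (Finsupp.single (machine.init []) 1) = machine.stateAt [] 1 := rfl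
  rw [h1, stateAt_nil_one, QTM.evolve_add, evolve_single_cfg, evolve_single_cfg]
  simp only [rot]
  rw [add_add_add_comm, ← Finsupp.single_add, ← Finsupp.single_add]
  congr 1 <;> congr 1 <;> norm_num

/-- **Tree semantics: the accepting state `ℓ` is observed with probability `576/625` after two
steps on the empty input** (Bernstein–Vazirani's model: `288/625`). [folklore] -/
theorem acceptProbAt_nil_two : machine.acceptProbAt [] 2 = 576 / 625 := by
  unfold QTM.acceptProbAt
  rw [stateAt_nil_two, Finsupp.sum_add_index_of_disjoint]
  · rw [Finsupp.sum_single_index, Finsupp.sum_single_index]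
    · simp [cfg]
      norm_num
    · simp
    · simp
  · exact Disjoint.mono Finsupp.support_single_subset Finsupp.support_single_subset
      (Finset.disjoint_singleton.2 (cfg_injective.ne (by decide)))

/-! #### The rotation walk in Bernstein–Vazirani's (positioned) model: `Pr[accept] = 288/625` after two steps -/

/-- One step from a blank-tape configuration at head position `ξ`, in the positioned model: the
two head moves now land on DIFFERENT configurations (positions `ξ - 1`, `ξ + 1`). [folklore] -/
theorem pevolve_single_cfg (p : Bool) (ξ : ℤ) (a : ℂ) :
    machine.pevolve (Finsupp.single (cfg p, ξ) a) =
      Finsupp.single (cfg false, ξ - 1) (a * rot false p) +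
        Finsupp.single (cfg true, ξ + 1) (a * rot true p) := by
  show machine.pevolveWith machine.δ (Finsupp.single (cfg p, ξ) a) = _
  unfold QTM.pevolveWith
  rw [Finsupp.sum_single_index (machine.pstep_zero _ _)]
  simp only [QTM.pstep]
  erw [Fintype.sum_bool, Fintype.sum_bool, Fintype.sum_bool]
  simp only [cfg, show blank.head = false from rfl, blank_write, blank_move]
  simp [dirOf]
  exact add_comm _ _

/-- After one step on the empty input (positioned model): `-(4/5)|ℓ,-1⟩ + (3/5)|r,1⟩`. [folklore] -/
theorem pstateAt_nil_one :
    machine.pstateAt [] 1 =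
      Finsupp.single (cfg false, (-1 : ℤ)) (-4 / 5) + Finsupp.single (cfg true, (1 : ℤ)) (3 / 5) := by
  rw [QTM.pstateAt_succ]
  show machine.pevolve (Finsupp.single (machine.pinit []) 1) = _
  rw [show machine.pinit [] = (cfg true, (0 : ℤ)) from rfl, pevolve_single_cfg]
  simp [rot]

/-- After two steps on the empty input (positioned model) FOUR orthogonal configurations carry
amplitude: `-(12/25)|ℓ,-2⟩ - (16/25)|r,0⟩ - (12/25)|ℓ,0⟩ + (9/25)|r,2⟩` (the tree merges them
into two, `RotationWalk.stateAt_nil_two`). [folklore] -/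
theorem pstateAt_nil_two :
    machine.pstateAt [] 2 =
      (Finsupp.single (cfg false, (-2 : ℤ)) (-12 / 25) +
          Finsupp.single (cfg true, (0 : ℤ)) (-16 / 25)) +
        (Finsupp.single (cfg false, (0 : ℤ)) (-12 / 25) +
          Finsupp.single (cfg true, (2 : ℤ)) (9 / 25)) := by
  rw [QTM.pstateAt_succ, pstateAt_nil_one]
  show machine.pevolveWith machine.δ _ = _
  rw [QTM.pevolveWith_add]
  show machine.pevolve _ + machine.pevolve _ = _
  rw [pevolve_single_cfg, pevolve_single_cfg]
  simp only [rot]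
  congr 1
  · congr 1
    · congr 1; norm_num
    · congr 1; norm_num
  · congr 1
    · congr 1; norm_num
    · congr 1; norm_num

/-- **Bernstein–Vazirani semantics: the accepting state `ℓ` is observed with probability
`288/625` after two steps on the empty input** (tree semantics: `576/625`,
`RotationWalk.acceptProbAt_nil_two`) — the number quoted in the docstrings of
`QuantumTuring.lean` and of this file, now proved. [folklore] -/
theorem pacceptProbAt_nil_two : machine.pacceptProbAt [] 2 = 288 / 625 := by
  classical
  unfold QTM.pacceptProbAt
  rw [pstateAt_nil_two, Finsupp.sum_add_index_of_disjoint, Finsupp.sum_add_index_of_disjoint,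
    Finsupp.sum_add_index_of_disjoint]
  · rw [Finsupp.sum_single_index, Finsupp.sum_single_index, Finsupp.sum_single_index,
      Finsupp.sum_single_index]
    · simp [cfg]
      norm_num
    all_goals simp
  · exact Disjoint.mono Finsupp.support_single_subset Finsupp.support_single_subset
      (Finset.disjoint_singleton.2 (by simp [cfg]))
  · exact Disjoint.mono Finsupp.support_single_subset Finsupp.support_single_subset
      (Finset.disjoint_singleton.2 (by simp [cfg]))
  · refine Disjoint.mono Finsupp.support_add Finsupp.support_add ?_
    rw [Finset.disjoint_union_left, Finset.disjoint_union_right, Finset.disjoint_union_right]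
    refine ⟨⟨?_, ?_⟩, ?_, ?_⟩ <;>
      exact Disjoint.mono Finsupp.support_single_subset Finsupp.support_single_subset
        (Finset.disjoint_singleton.2 (by simp [cfg]))

end RotationWalk

end Literature.Computability.QuantumComplexity
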